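import Literature.Algebra.Lie.LefschetzModulePrimitive
import HarnessLib

/-!
# The `𝔰𝔩₂`-type of an irreducible Lefschetz module is an arithmetic progression (Looijenga–Lunts 1997, (1.15))

Topic `Literature/Algebra/Lie` (namespace `Literature.Algebra.Lie`).  Lane `lit-hodgefound` (Track 2 foundations
library), skeleton seat `lit-hodgefound-skel-1` (generation 42), row **A1-113** of
`run/shared/lean/pub/lit-hodgefound/SKELETON.md`: Looijenga–Lunts' (1.15) Proposition, first statement, with its
printed proof, for Lefschetz MODULES `(𝔞, M)` (A1-88 `IsLefschetzModule`; the representations of a Lefschetz pair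
`(𝔤, h)` are Lefschetz modules by A1-106).  PROVED theorems and one definition with body (`typeLE`, the sum of the
`𝔰𝔩₂`-isotypic components of types `V(j)`, `j ≤ k`, written as a sum of kernels); no named fact, no `sorry`
(D-0026 net debt `0`).  `LieRing.ofAssociativeRing` is enabled FILE-LOCALLY as in the rest of the series.

## Source, VERBATIM

E. Looijenga, V. A. Lunts, *A Lie algebra attached to a projective variety*, Invent. Math. **129** (1997) 361–412,
§1 (1.15) (held text `paper:arxiv-alg-geom_9604014`, p0007 L106–L110, p0008 L1–L33):

> "Let `V(k)` denote the standard irreducible representation of `𝔰𝔩(2)` of dimension `k+1` (`k = 1, 2, …`).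
> (1.15) Proposition. Let `(𝔤, h)` be a Lefschetz pair and let `M` be an irreducible representation of `𝔤` of depth
> `n`. Then the dimensions of the irreducible `𝔰𝔩(2)`-representations that occur in the `𝔰𝔩(2)`-type of `M` make
> up an arithmetic progression with increment `2`. In other words, there exists an integer `r` with
> `0 ≤ r ≤ ⌊n/2⌋` such that `dim M_{-n} < dim M_{-n+2} < ⋯ < dim M_{-n+2r} = dim M_{-n+2r+2} = ⋯ = dim M_{n-2r} <
> dim M_{n-2r+2} < ⋯ < dim M_n`. Moreover, `r > 0` unless (i) the image of `𝔤` in `𝔤𝔩(M)` is reduced to `𝔰𝔩(2)`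
> with `M ≅ V(n)` or (ii) the `𝔰𝔩(2)`-type of `M` consists of a number of copies of `V(1)`.
> Proof. Denote this set of dimensions by `I`. The irreducibility of `M` implies that the elements of `I` all have
> the same parity. Suppose `I` is not an arithmetic progression with increment `2`. Then there exists an integer
> `k` such that `M` contains `V(k)` […] and `V(k+2l)` for some `l ≥ 2`, but not `V(k+2)`. Let `(e, h, f)` be an
> `𝔰𝔩(2)`-triple in `𝔤` containing `h` and decompose `M` as `M = M' ⊕ M''` with `M'` resp. `M''` the sum of the
> irreducible subrepresentations of `𝔰𝔩(2)` of `dim ≤ k+1` resp. `≥ k+5`. Any linear transformation in `M` of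
> degree two that commutes with `e` must preserve this decomposition, because any `K[e]`-linear homomorphism
> `V(n) ≅ K[e]/(e^{n+1})[n] → K[e]/(e^{m+1})[m] ≅ V(m)` of degree two is zero if `|n - m| > 2`. If `(𝔤, h, 𝔞)` is a
> Lefschetz triple with `e ∈ 𝔞`, then this applies in particular to any `e' ∈ 𝔞`. If `e'` has the Lefschetz
> property, then `f_{e'}` will also preserve this decomposition (since `f_{e'}` is unique) and hence `𝔤` will. This
> contradicts our assumption that `M` is irreducible."

## Rendering (dictionary)

* "`(𝔤, h)` a Lefschetz pair, `M` an irreducible representation": a Lefschetz module `(𝔞, M)` (A1-88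
  `IsLefschetzModule K h 𝔞`, `𝔞 ≤ 𝔤𝔩(M)`) that is irreducible as a `𝔤(𝔞, M)`-module (Mathlib
  `LieModule.IsIrreducible`, as in A1-103); for a representation `ρ ≠ 0` of a Lefschetz triple `(𝔤, h, 𝔞)` this is
  the module `(ρ 𝔞, M)` with `𝔤(ρ 𝔞, M) = ρ(𝔤)` (A1-106 `IsLefschetzTriple.isLefschetzModule_toEnd`,
  `lefschetzLieAlgebra_map_toEnd`).
* "`(e, h, f)` an `𝔰𝔩(2)`-triple in `𝔤` containing `h`", "`e ∈ 𝔞`": Mathlib `IsSl2Triple h a f` with `a ∈ 𝔞`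
  (so `f = f_a`).
* "`M` contains `V(j)`": `primitiveSpace h a j ≠ ⊥` — the space `P_{-j} = M_{-j} ∩ ker a^{j+1}` of A1-88, which is
  the space `M_{-j} ∩ ker f` of LOWEST weight vectors of weight `-j` (`primitiveSpace_eq_inf_ker`), i.e. of the
  bottoms of the strings `V(j) ⊆ M`.
* "`M'`, the sum of the irreducible subrepresentations of `𝔰𝔩(2)` of `dim ≤ k+1`" = `typeLE h f k :=
  ⨆_{t ∈ ℕ} M_{2t-k} ∩ ker f^{t+1}` (a weight vector of weight `2t - k` inside a copy of `V(j)`, `j ≡ k (2)`, is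
  killed by `f^{t+1}` iff `j ≤ k`).  `M''` is not needed: it suffices that `M'` is `𝔤(𝔞, M)`-stable and
  `0 ≠ M' ≠ M`.

## Contents (all proved)

* §1 `typeLE` and its elementary properties (`mem_typeLE`, `primitive` bottoms, stability under `h` and `f`,
  `typeLE_le_biSup`).
* §2 **"Any linear transformation in `M` of degree two that commutes with `e` must preserve this decomposition"**:
  `typeLE_stable_of_lie_eq_zero` — for `e'` of degree `2` with `[f, [f, [f, e']]] = 0` (which holds when
  `[a, e'] = 0`, `isNilpotent_ad_f_of_lie_eq_zero`-style lemma `lie_f_lie_f_lie_f_eq_zero`: `e'` is a highest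
  weight vector of weight `2` for `(a, h, f)` acting on `𝔤𝔩(M)`) and `M_{-k-2} ∩ ker f = 0` ("not `V(k+2)`"),
  `e'(M') ⊆ M'`.  The printed `K[e]`-module argument is replaced by the equivalent `f`-kernel computation
  `f^{t+2}(e' x) = (t+1 choose 2)·[f,[f,e']](f^t x)` on `M_{2t-k} ∩ ker f^{t+1}`, whose right-hand side is a lowest
  weight vector of weight `-k-2`, hence zero.
* §3 **"If `e'` has the Lefschetz property, then `f_{e'}` will also preserve this decomposition (since `f_{e'}` is
  unique)"**: `dual_apply_mem_of_stable` — a subspace `N` stable under a Lefschetz `e'` on which `e'^m : N_{-m} →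
  N_m` is onto is spanned by `e'`-strings of primitive vectors, on which the unique partner `f_{e'}` is André's
  operator (A1-88 `dual_apply_pow_primitive`); ontoness for `N = M'` comes from `dim M'_{-m} = dim M'_m`
  (`finrank_inf_degreeSpace_neg_eq`, `M'` being stable under `a` and `f`).
* §4 **(1.15), first statement**: `IsLefschetzModule.typeLE_stable` (`M'` is `𝔤(𝔞, M)`-stable),
  **`IsLefschetzModule.degreeSpace_eq_bot_of_primitiveSpace_eq_bot`** (if `V(k)` occurs and `V(k+2)` does not,
  then `M_m = 0` for all `m < -k`), **`IsLefschetzModule.depth_eq_of_primitiveSpace_eq_bot`** (then `k` is the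
  depth `n`), **`IsLefschetzModule.primitiveSpace_add_two_ne_bot`** (no gaps: `V(j)` occurs, `j + 2 ≤ n` ⟹
  `V(j+2)` occurs) and **`IsLefschetzModule.exists_primitiveSpace_ne_bot_iff`** (the occurring `V(n - 2t)`,
  `2t ≤ n`, are exactly those with `t ≤ r`).
* §5 "In other words": `finrank_degreeSpace_neg_eq_add` (`dim M_{-j} = dim P_{-j} + dim M_{-j-2}`),
  `finrank_degreeSpace_eq_neg` (`dim M_j = dim M_{-j}`), hence the printed chain of (in)equalities
  (`finrank_lt_of_primitiveSpace_ne_bot`, `finrank_eq_of_primitiveSpace_eq_bot`).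

## SCOPE (what is NOT formalised here)

(a) The second sentence "Moreover, `r > 0` unless (i) … or (ii) …" (its printed proof passes to an algebraically
closed field) is not formalised.  (b) The statement is given for Lefschetz modules; the passage from an irreducible
representation of a Lefschetz pair is A1-106 (`IsLefschetzTriple.isLefschetzModule_toEnd`).  (c) Nothing here
concerns complex tori or the Hodge conjecture.

## References

* [LooijengaLunts1997] E. Looijenga, V. A. Lunts, *A Lie algebra attached to a projective variety*, Invent. Math. 129
  (1997) 361–412; arXiv:alg-geom/9604014. §1 (1.15), p. 7 L106 – p. 8 L33 of the held text; (1.1) p. 4.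
* [Andre1996Motifs] Y. André, *Pour une théorie inconditionnelle des motifs*, Publ. Math. IHÉS 83 (1996) 5–49,
  §1.1 (the operator `ᶜΛ`; used through A1-88).
-/

namespace Literature.Algebra.Lie

open Module Function Set LieModule LieAlgebra
open HasLefschetzProperty (primitiveSpace mem_primitiveSpace_iff)

-- The commutator Lie ring of `𝔤𝔩(M) = Module.End K M`: Mathlib's reducible NON-instance, enabled file-locally
-- exactly as in `LefschetzModule.lean`.
attribute [local instance 100] LieRing.ofAssociativeRing

/-! ### §1 The subspace `M' = M^{(≤ k)}` of `𝔰𝔩₂`-types `V(j)`, `j ≤ k` -/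

section TypeLE

variable {K : Type*} [Field K] {M : Type*} [AddCommGroup M] [Module K M] {h a f : Module.End K M}

/-- An operator `f` of degree `-2` (`[h, f] = -2f`) lowers the degree by `2`: `f (M_m) ⊆ M_{m-2}`.
[cite: LooijengaLunts1997, §1 (1.1) p. 3 L110–L111 ("u has degree k iff [h, u] = ku")] -/
theorem apply_mem_degreeSpace_sub_two (hf : ⁅h, f⁆ = -(2 • f)) {m : ℤ} {x : M} (hx : x ∈ degreeSpace h m) :
    f x ∈ degreeSpace h (m - 2) :=
  mapsTo_of_lie_eq_neg_two_nsmul hf m hx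

/-- `f^n (M_m) ⊆ M_{m-2n}` for `f` of degree `-2`. [cite: LooijengaLunts1997, §1 (1.1) p. 3 L110–L111 ("u has degree k iff [h, u] = ku")] -/
theorem pow_apply_mem_degreeSpace_of_neg (hf : ⁅h, f⁆ = -(2 • f)) {m : ℤ} {x : M} (hx : x ∈ degreeSpace h m)
    (n : ℕ) : (f ^ n) x ∈ degreeSpace h (m - 2 * n) := by
  induction n with
  | zero => simpa using hx
  | succ n ih =>
    rw [pow_succ', Module.End.mul_apply]
    have h1 : f ((f ^ n) x) ∈ degreeSpace h (m - 2 * n - 2) := apply_mem_degreeSpace_sub_two hf ih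
    convert h1 using 2
    push_cast
    ring

/-- `(M, -h)_k = (M, h)_{-k}`. [cite: LooijengaLunts1997, §1 (1.1) p. 3 L106–L111] -/
theorem degreeSpace_neg (h : Module.End K M) (k : ℤ) : degreeSpace (-h) k = degreeSpace h (-k) := by
  ext x
  rw [mem_degreeSpace_iff, mem_degreeSpace_iff, LinearMap.neg_apply, Int.cast_neg, neg_smul, neg_eq_iff_eq_neg]

/-- `(M, -h)` is `ℤ`-graded when `(M, h)` is. [cite: LooijengaLunts1997, §1 (1.1) p. 3 L106–L111] -/
theorem isZGrading_neg (hgr : IsZGrading h) : IsZGrading (-h) := by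
  rw [IsZGrading, eq_top_iff, ← hgr]
  exact iSup_le fun k ↦ le_iSup_of_le (f := fun k : ℤ ↦ degreeSpace (-h) k) (-k) (by rw [degreeSpace_neg, neg_neg])

/-- **`M' = M^{(≤ k)}`, "the sum of the irreducible subrepresentations of `𝔰𝔩(2)` of `dim ≤ k+1`"** (of the parity
of `k`), for the triple `(a, h, f)`: the sum over `t ≥ 0` of `M_{2t-k} ∩ ker f^{t+1}` — the weight-`(2t-k)`
vectors of the copies of `V(j)` with `j ≤ k`. [cite: LooijengaLunts1997, §1 (1.15) proof, p. 8 L22–L24] -/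
def typeLE (h f : Module.End K M) (k : ℕ) : Submodule K M :=
  ⨆ t : ℕ, degreeSpace h (2 * (t : ℤ) - k) ⊓ LinearMap.ker (f ^ (t + 1))

/-- Membership of a homogeneous vector: `x ∈ M_{2t-k}` with `f^{t+1} x = 0` lies in `M'`.
[cite: LooijengaLunts1997, §1 (1.15) proof, p. 8 L22–L24] -/
theorem mem_typeLE {k t : ℕ} {x : M} (hx : x ∈ degreeSpace h (2 * (t : ℤ) - k)) (hfx : (f ^ (t + 1)) x = 0) :
    x ∈ typeLE h f k :=
  Submodule.mem_iSup_of_mem (p := fun t : ℕ ↦ degreeSpace h (2 * (t : ℤ) - k) ⊓ LinearMap.ker (f ^ (t + 1))) t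
    (Submodule.mem_inf.2 ⟨hx, LinearMap.mem_ker.2 hfx⟩)

/-- The bottoms of the `V(k)`-strings lie in `M'`: `M_{-k} ∩ ker f ⊆ M'` (the term `t = 0`).
[cite: LooijengaLunts1997, §1 (1.15) proof, p. 8 L22–L24] -/
theorem mem_typeLE_of_apply_eq_zero {k : ℕ} {x : M} (hx : x ∈ degreeSpace h (-(k : ℤ))) (hfx : f x = 0) :
    x ∈ typeLE h f k :=
  mem_typeLE (t := 0) (by simpa using hx) (by simpa using hfx)

/-- `M' ⊆ M_{≥ -k}`: all its pieces have degrees `2t - k ≥ -k`. [cite: LooijengaLunts1997, §1 (1.15) proof, p. 8 L22–L24] -/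
theorem typeLE_le_biSup (k : ℕ) : typeLE h f k ≤ ⨆ m : ℤ, ⨆ (_ : -(k : ℤ) ≤ m), degreeSpace h m :=
  iSup_le fun t ↦ inf_le_left.trans
    (le_iSup₂_of_le (f := fun m (_ : -(k : ℤ) ≤ m) ↦ degreeSpace h m) (2 * (t : ℤ) - k) (by omega) le_rfl)

/-- An induction principle: a property of vectors closed under `0` and `+` and true on the homogeneous pieces
`M_{2t-k} ∩ ker f^{t+1}` holds on `M'`. [cite: LooijengaLunts1997, §1 (1.15) proof, p. 8 L22–L24] -/
theorem typeLE_induction {k : ℕ} {p : M → Prop}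
    (hp : ∀ t : ℕ, ∀ x ∈ degreeSpace h (2 * (t : ℤ) - k), (f ^ (t + 1)) x = 0 → p x) (h0 : p 0)
    (hadd : ∀ x y, p x → p y → p (x + y)) {x : M} (hx : x ∈ typeLE h f k) : p x := by
  refine Submodule.iSup_induction (fun t : ℕ ↦ degreeSpace h (2 * (t : ℤ) - k) ⊓ LinearMap.ker (f ^ (t + 1)))
    (motive := p) hx (fun t x hx ↦ hp t x hx.1 (LinearMap.mem_ker.1 hx.2)) h0 hadd

/-- `M'` is stable under `h` (it is spanned by homogeneous vectors). [cite: LooijengaLunts1997, §1 (1.15) proof, p. 8 L22–L24] -/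
theorem h_apply_mem_typeLE {k : ℕ} {x : M} (hx : x ∈ typeLE h f k) : h x ∈ typeLE h f k := by
  refine typeLE_induction (p := fun x ↦ h x ∈ typeLE h f k) (fun t x hx hfx ↦ ?_)
    (by rw [map_zero]; exact Submodule.zero_mem _) (fun x y hx hy ↦ by rw [map_add]; exact Submodule.add_mem _ hx hy)
    hx
  rw [mem_degreeSpace_iff.1 hx]
  exact Submodule.smul_mem _ _ (mem_typeLE hx hfx)

/-- `M'` is stable under `f` (`f` lowers the degree by `2`: `f (M_{2t-k} ∩ ker f^{t+1}) ⊆ M_{2(t-1)-k} ∩ ker f^t`).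
[cite: LooijengaLunts1997, §1 (1.15) proof, p. 8 L22–L24] -/
theorem f_apply_mem_typeLE (hf : ⁅h, f⁆ = -(2 • f)) {k : ℕ} {x : M} (hx : x ∈ typeLE h f k) :
    f x ∈ typeLE h f k := by
  refine typeLE_induction (p := fun x ↦ f x ∈ typeLE h f k) (fun t x hx hfx ↦ ?_)
    (by rw [map_zero]; exact Submodule.zero_mem _) (fun x y hx hy ↦ by rw [map_add]; exact Submodule.add_mem _ hx hy)
    hx
  rcases t with _ | s
  · rw [zero_add, pow_one] at hfx
    rw [hfx]
    exact Submodule.zero_mem _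
  · refine mem_typeLE (t := s) ?_ ?_
    · have h1 := apply_mem_degreeSpace_sub_two hf hx
      convert h1 using 2
      push_cast
      ring
    · rw [← Module.End.mul_apply, ← pow_succ, hfx]

end TypeLE

/-! ### §2 Operators of degree `2` commuting with `e = a` preserve `M'` when `V(k+2)` does not occur -/

section DegreeTwo

variable {K : Type*} [Field K] {M : Type*} [AddCommGroup M] [Module K M] {h f e' : Module.End K M} {k : ℕ}

/-- The operator `u = [f, e']` has degree `0` when `e'` has degree `2` and `f` degree `-2`. [folklore] -/
private theorem u_apply_mem (hf : ⁅h, f⁆ = -(2 • f)) (he' : ∀ m : ℤ, MapsTo e' (degreeSpace h m) (degreeSpace h (m + 2)))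
    {m : ℤ} {x : M} (hx : x ∈ degreeSpace h m) : (f * e' - e' * f) x ∈ degreeSpace h m := by
  rw [LinearMap.sub_apply, Module.End.mul_apply, Module.End.mul_apply]
  refine Submodule.sub_mem _ ?_ ?_
  · have h0 : e' x ∈ degreeSpace h (m + 2) := he' m hx
    have h1 := apply_mem_degreeSpace_sub_two hf h0
    convert h1 using 2; ring
  · have h1 : e' (f x) ∈ degreeSpace h (m - 2 + 2) := he' _ (apply_mem_degreeSpace_sub_two hf hx)
    convert h1 using 2; ring

/-- The operator `e'' = [f, [f, e']]` has degree `-2`. [folklore] -/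
private theorem e''_apply_mem (hf : ⁅h, f⁆ = -(2 • f))
    (he' : ∀ m : ℤ, MapsTo e' (degreeSpace h m) (degreeSpace h (m + 2))) {m : ℤ} {x : M} (hx : x ∈ degreeSpace h m) :
    (f * (f * e' - e' * f) - (f * e' - e' * f) * f) x ∈ degreeSpace h (m - 2) := by
  rw [LinearMap.sub_apply, Module.End.mul_apply, Module.End.mul_apply]
  refine Submodule.sub_mem _ ?_ ?_
  · exact apply_mem_degreeSpace_sub_two hf (u_apply_mem hf he' hx)
  · exact u_apply_mem hf he' (apply_mem_degreeSpace_sub_two hf hx)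

/-- `f^{n+1} (u x) = f^n (u (f x)) + f^n (e'' x)` with `u = [f, e']`, `e'' = [f, u]`. [folklore] -/
private theorem pow_succ_u_apply (n : ℕ) (x : M) :
    (f ^ (n + 1)) ((f * e' - e' * f) x) =
      (f ^ n) ((f * e' - e' * f) (f x)) + (f ^ n) ((f * (f * e' - e' * f) - (f * e' - e' * f) * f) x) := by
  rw [← map_add, pow_succ, Module.End.mul_apply]
  congr 1
  simp only [LinearMap.sub_apply, Module.End.mul_apply, map_sub]
  abel

/-- `f^{n+1} (e' x) = f^n (e' (f x)) + f^n (u x)`. [folklore] -/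
private theorem pow_succ_e'_apply (n : ℕ) (x : M) :
    (f ^ (n + 1)) (e' x) = (f ^ n) (e' (f x)) + (f ^ n) ((f * e' - e' * f) x) := by
  rw [← map_add, pow_succ, Module.End.mul_apply]
  congr 1
  simp only [LinearMap.sub_apply, Module.End.mul_apply]
  abel

/-- When `[f, e''] = 0`, `f^n (e'' x) = e'' (f^n x)`. [folklore] -/
private theorem pow_e''_apply (h3 : f * (f * (f * e' - e' * f) - (f * e' - e' * f) * f) =
      (f * (f * e' - e' * f) - (f * e' - e' * f) * f) * f) (n : ℕ) (x : M) :
    (f ^ n) ((f * (f * e' - e' * f) - (f * e' - e' * f) * f) x) =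
      (f * (f * e' - e' * f) - (f * e' - e' * f) * f) ((f ^ n) x) := by
  have hc0 : Commute f (f * (f * e' - e' * f) - (f * e' - e' * f) * f) := h3
  have hc : Commute (f ^ n) (f * (f * e' - e' * f) - (f * e' - e' * f) * f) := hc0.pow_left n
  rw [← Module.End.mul_apply, hc.eq, Module.End.mul_apply]

/-- The GAP step: if `M_{-(k+2)} ∩ ker f = 0` ("`M` does not contain `V(k+2)`"), `[f, e''] = 0` and `e''` has
degree `-2`, then `e''` kills the lowest weight vectors of weight `-k`: for `y ∈ M_{-k}` with `f y = 0`,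
`e'' y ∈ M_{-k-2} ∩ ker f = 0`. [cite: LooijengaLunts1997, §1 (1.15) proof, p. 8 L24–L31] -/
private theorem e''_apply_eq_zero_of_gap (hf : ⁅h, f⁆ = -(2 • f))
    (he' : ∀ m : ℤ, MapsTo e' (degreeSpace h m) (degreeSpace h (m + 2)))
    (h3 : f * (f * (f * e' - e' * f) - (f * e' - e' * f) * f) =
      (f * (f * e' - e' * f) - (f * e' - e' * f) * f) * f)
    (hgap : degreeSpace h (-((k + 2 : ℕ) : ℤ)) ⊓ LinearMap.ker f = ⊥) {y : M} (hy : y ∈ degreeSpace h (-(k : ℤ)))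
    (hfy : f y = 0) : (f * (f * e' - e' * f) - (f * e' - e' * f) * f) y = 0 := by
  have h1 : (f * (f * e' - e' * f) - (f * e' - e' * f) * f) y ∈ degreeSpace h (-((k + 2 : ℕ) : ℤ)) := by
    have h2 := e''_apply_mem hf he' hy
    convert h2 using 2
    push_cast
    ring
  have h2 : (f * (f * e' - e' * f) - (f * e' - e' * f) * f) y ∈ LinearMap.ker f := by
    rw [LinearMap.mem_ker, ← Module.End.mul_apply, h3, Module.End.mul_apply, hfy, map_zero]
  have h4 : (f * (f * e' - e' * f) - (f * e' - e' * f) * f) y ∈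
      degreeSpace h (-((k + 2 : ℕ) : ℤ)) ⊓ LinearMap.ker f := ⟨h1, h2⟩
  rw [hgap] at h4
  exact (Submodule.mem_bot K).1 h4

/-- Claim B: `f^{t+1} (u x) = 0` for `x ∈ M_{2t-k} ∩ ker f^{t+1}` (induction on `t`; the new term at each step is
`e''` applied to a lowest weight vector of weight `-k`, zero by the gap). [cite: LooijengaLunts1997, §1 (1.15) proof, p. 8 L24–L31] -/
private theorem pow_u_apply_eq_zero (hf : ⁅h, f⁆ = -(2 • f))
    (he' : ∀ m : ℤ, MapsTo e' (degreeSpace h m) (degreeSpace h (m + 2)))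
    (h3 : f * (f * (f * e' - e' * f) - (f * e' - e' * f) * f) =
      (f * (f * e' - e' * f) - (f * e' - e' * f) * f) * f)
    (hgap : degreeSpace h (-((k + 2 : ℕ) : ℤ)) ⊓ LinearMap.ker f = ⊥) (t : ℕ) {x : M}
    (hx : x ∈ degreeSpace h (2 * (t : ℤ) - k)) (hfx : (f ^ (t + 1)) x = 0) :
    (f ^ (t + 1)) ((f * e' - e' * f) x) = 0 := by
  induction t generalizing x with
  | zero =>
    rw [zero_add, pow_one] at hfx
    rw [pow_succ_u_apply, pow_zero, Module.End.one_apply, Module.End.one_apply, hfx, map_zero, zero_add]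
    exact e''_apply_eq_zero_of_gap hf he' h3 hgap (by simpa using hx) hfx
  | succ t ih =>
    have hfx' : f x ∈ degreeSpace h (2 * (t : ℤ) - k) := by
      have h1 := apply_mem_degreeSpace_sub_two hf hx
      convert h1 using 2
      push_cast
      ring
    have hffx : (f ^ (t + 1)) (f x) = 0 := by
      rw [← Module.End.mul_apply, ← pow_succ, hfx]
    rw [pow_succ_u_apply, ih hfx' hffx, zero_add, pow_e''_apply h3]
    refine e''_apply_eq_zero_of_gap hf he' h3 hgap ?_ ?_
    · have h1 := pow_apply_mem_degreeSpace_of_neg hf hx (t + 1)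
      convert h1 using 2
      push_cast
      ring
    · rw [← Module.End.mul_apply, ← pow_succ', hfx]

/-- Claim A: `f^{t+2} (e' x) = 0` for `x ∈ M_{2t-k} ∩ ker f^{t+1}`. [cite: LooijengaLunts1997, §1 (1.15) proof, p. 8 L24–L31] -/
private theorem pow_e'_apply_eq_zero (hf : ⁅h, f⁆ = -(2 • f))
    (he' : ∀ m : ℤ, MapsTo e' (degreeSpace h m) (degreeSpace h (m + 2)))
    (h3 : f * (f * (f * e' - e' * f) - (f * e' - e' * f) * f) =
      (f * (f * e' - e' * f) - (f * e' - e' * f) * f) * f)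
    (hgap : degreeSpace h (-((k + 2 : ℕ) : ℤ)) ⊓ LinearMap.ker f = ⊥) (t : ℕ) {x : M}
    (hx : x ∈ degreeSpace h (2 * (t : ℤ) - k)) (hfx : (f ^ (t + 1)) x = 0) :
    (f ^ (t + 2)) (e' x) = 0 := by
  induction t generalizing x with
  | zero =>
    have h1 := pow_u_apply_eq_zero hf he' h3 hgap 0 hx hfx
    rw [zero_add, pow_one] at hfx h1
    have hfe : f (e' x) = e' (f x) + (f * e' - e' * f) x := by
      simp only [LinearMap.sub_apply, Module.End.mul_apply]
      abel
    rw [zero_add, pow_two, Module.End.mul_apply, hfe, hfx, map_zero, zero_add, h1]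
  | succ t ih =>
    have hfx' : f x ∈ degreeSpace h (2 * (t : ℤ) - k) := by
      have h1 := apply_mem_degreeSpace_sub_two hf hx
      convert h1 using 2
      push_cast
      ring
    have hffx : (f ^ (t + 1)) (f x) = 0 := by
      rw [← Module.End.mul_apply, ← pow_succ, hfx]
    have h2 := pow_u_apply_eq_zero hf he' h3 hgap (t + 1) hx hfx
    rw [show t + 1 + 2 = (t + 2) + 1 by ring, pow_succ_e'_apply, ih hfx' hffx, zero_add]
    exact h2

/-- **"Any linear transformation in `M` of degree two that commutes with `e` must preserve this decomposition"** —
in the form used: an operator `e'` of degree `2` with `[f, [f, [f, e']]] = 0` (this holds when `[a, e'] = 0`,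
`lie_f_lie_f_lie_f_eq_zero`) preserves `M' = M^{(≤ k)}` as soon as `M_{-k-2} ∩ ker f = 0` ("`M` contains … not
`V(k+2)`").  Printed reason: a `K[e]`-linear map `V(n) → V(m)` of degree two vanishes for `|n - m| > 2`; here:
`f^{t+2} (e' x) = 0` on `M_{2t-k} ∩ ker f^{t+1}` (§2 claims A, B). [cite: LooijengaLunts1997, §1 (1.15) proof, p. 8 L24–L31] -/
theorem typeLE_stable_of_lie_eq_zero (hf : ⁅h, f⁆ = -(2 • f))
    (he' : ∀ m : ℤ, MapsTo e' (degreeSpace h m) (degreeSpace h (m + 2))) (h3 : ⁅f, ⁅f, ⁅f, e'⁆⁆⁆ = 0)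
    (hgap : degreeSpace h (-((k + 2 : ℕ) : ℤ)) ⊓ LinearMap.ker f = ⊥) {x : M} (hx : x ∈ typeLE h f k) :
    e' x ∈ typeLE h f k := by
  have h3' : f * (f * (f * e' - e' * f) - (f * e' - e' * f) * f) =
      (f * (f * e' - e' * f) - (f * e' - e' * f) * f) * f := by
    simp only [Ring.lie_def] at h3
    exact sub_eq_zero.1 h3
  refine typeLE_induction (p := fun x ↦ e' x ∈ typeLE h f k) (fun t x hx hfx ↦ ?_)
    (by rw [map_zero]; exact Submodule.zero_mem _) (fun x y hx hy ↦ by rw [map_add]; exact Submodule.add_mem _ hx hy)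
    hx
  refine mem_typeLE (t := t + 1) ?_ (pow_e'_apply_eq_zero hf he' h3' hgap t hx hfx)
  have h1 : e' x ∈ degreeSpace h (2 * (t : ℤ) - k + 2) := he' _ hx
  convert h1 using 2
  push_cast
  ring

end DegreeTwo

/-! ### §3 "since `f_{e'}` is unique": the partner of a Lefschetz `e'` preserves an `e'`-stable subspace with symmetric dimensions -/

section Partner

variable {K : Type*} [Field K] [CharZero K] {M : Type*} [AddCommGroup M] [Module K M] [FiniteDimensional K M]
  {h : Module.End K M}

/-- In an `𝔰𝔩₂`-triple `(a, h, f)` of `𝔤𝔩(M)` on a `ℤ`-graded `(M, h)`, **`f` is a Lefschetz operator for `-h`**: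
`f^m : M_m ≅ M_{-m}` (A1-88 (1.1) "⇐" for the opposite triple `(f, -h, a)`). [cite: LooijengaLunts1997, §1 (1.1) p. 4 L1–L5] -/
theorem hasLefschetzProperty_f (hgr : IsZGrading h) {a f : Module.End K M} (t : IsSl2Triple h a f) :
    HasLefschetzProperty (-h) f :=
  hasLefschetzProperty_of_isSl2Triple (isZGrading_neg hgr) t.symm

/-- `f^m` is injective on `M_m`. [cite: LooijengaLunts1997, §1 (1.1) p. 4 L1–L5] -/
theorem eq_zero_of_pow_f_apply_eq_zero (hgr : IsZGrading h) {a f : Module.End K M} (t : IsSl2Triple h a f) {m : ℕ}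
    {x : M} (hx : x ∈ degreeSpace h m) (h0 : (f ^ m) x = 0) : x = 0 := by
  refine (hasLefschetzProperty_f hgr t).eq_zero_of_pow_apply_eq_zero (n := m) (by omega) ?_ (by simpa using h0)
  rw [degreeSpace_neg, neg_neg]
  exact hx

/-- **The primitive space is the space of lowest weight vectors: `P_{-j} = M_{-j} ∩ ker f`** (`f p = 0` for `p`
primitive — André's `ᶜΛ`, A1-88; conversely a vector of weight `-j` killed by `f` spans, under `a`, a copy of
`V(j)`, so `a^{j+1}` kills it — Mathlib's `pow_toEnd_f_eq_zero_of_eq_nat` for the opposite triple).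
[cite: LooijengaLunts1997, §1 (1.15) p. 8 L21–L23 ("V(n) ≅ K[e]/(e^{n+1})[n]")] -/
theorem primitiveSpace_eq_inf_ker (hgr : IsZGrading h) {a f : Module.End K M} (t : IsSl2Triple h a f) (j : ℕ) :
    primitiveSpace h a j = degreeSpace h (-(j : ℤ)) ⊓ LinearMap.ker f := by
  have La := hasLefschetzProperty_of_isSl2Triple hgr t
  ext x
  rw [Submodule.mem_inf, LinearMap.mem_ker]
  constructor
  · intro hx
    refine ⟨(mem_primitiveSpace_iff.1 hx).1, ?_⟩
    rw [La.eq_dual_of_isSl2Triple hgr t]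
    exact La.dual_apply_primitive hgr hx
  · rintro ⟨hx, hfx⟩
    rw [mem_primitiveSpace_iff]
    refine ⟨hx, ?_⟩
    by_cases hx0 : x = 0
    · rw [hx0, map_zero]
    · -- `x` is a primitive vector of weight `j` for the opposite triple `(f, -h, a)` acting on `M`
      have P : t.symm.HasPrimitiveVectorWith x (j : K) :=
        { ne_zero := hx0
          lie_h := by
            rw [Module.End.lie_apply, LinearMap.neg_apply, mem_degreeSpace_iff.1 hx, Int.cast_neg, Int.cast_natCast,
              neg_smul, neg_neg]
          lie_e := by rw [Module.End.lie_apply, hfx] }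
      have h1 := P.pow_toEnd_f_eq_zero_of_eq_nat (n := j) rfl
      simpa using h1

variable {N : Submodule K M}

/-- **`dim M'_{-m} = dim M'_m`** for a subspace `M'` stable under `a` and `f`: `a^m : M'_{-m} → M'_m` and
`f^m : M'_m → M'_{-m}` are injective. [cite: LooijengaLunts1997, §1 (1.15) proof, p. 8 L22–L24] -/
theorem finrank_inf_degreeSpace_neg_eq (hgr : IsZGrading h) {a f : Module.End K M} (t : IsSl2Triple h a f)
    (hNa : ∀ x ∈ N, a x ∈ N) (hNf : ∀ x ∈ N, f x ∈ N) (m : ℕ) :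
    finrank K ↥(N ⊓ degreeSpace h (-(m : ℤ))) = finrank K ↥(N ⊓ degreeSpace h m) := by
  have La := hasLefschetzProperty_of_isSl2Triple hgr t
  have hpowN : ∀ {g : Module.End K M}, (∀ x ∈ N, g x ∈ N) → ∀ n : ℕ, ∀ x ∈ N, (g ^ n) x ∈ N := by
    intro g hg n
    induction n with
    | zero => intro x hx; simpa using hx
    | succ n ih => intro x hx; rw [pow_succ', Module.End.mul_apply]; exact hg _ (ih x hx)
  refine le_antisymm ?_ ?_
  · -- `a^m` restricted
    refine LinearMap.finrank_le_finrank_of_injective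
      (f := (a ^ m).restrict (p := N ⊓ degreeSpace h (-(m : ℤ))) (q := N ⊓ degreeSpace h m) fun x hx ↦
        ⟨hpowN hNa m x hx.1, by simpa using (La.bijOn m).mapsTo hx.2⟩) fun x y hxy ↦ ?_
    apply Subtype.ext
    have h1 : (a ^ m) (x - y : M) = 0 := by
      rw [map_sub, sub_eq_zero]
      simpa [LinearMap.restrict_apply] using congrArg Subtype.val hxy
    exact sub_eq_zero.1 (La.eq_zero_of_pow_apply_eq_zero (n := m) (by omega) (Submodule.sub_mem _ x.2.2 y.2.2)
      (by simpa using h1))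
  · -- `f^m` restricted
    refine LinearMap.finrank_le_finrank_of_injective
      (f := (f ^ m).restrict (p := N ⊓ degreeSpace h m) (q := N ⊓ degreeSpace h (-(m : ℤ))) fun x hx ↦
        ⟨hpowN hNf m x hx.1, ?_⟩) fun x y hxy ↦ ?_
    · have h1 := ((hasLefschetzProperty_f hgr t).bijOn m).mapsTo (x := x) (by rw [degreeSpace_neg, neg_neg]; exact hx.2)
      rwa [degreeSpace_neg] at h1
    · apply Subtype.ext
      have h1 : (f ^ m) (x - y : M) = 0 := by
        rw [map_sub, sub_eq_zero]
        simpa [LinearMap.restrict_apply] using congrArg Subtype.val hxy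
      exact sub_eq_zero.1 (eq_zero_of_pow_f_apply_eq_zero hgr t (Submodule.sub_mem _ x.2.2 y.2.2) h1)

/-- For a subspace `M'` stable under `a`, `f` and a further Lefschetz operator `e'`, **`e'^m : M'_{-m} → M'_m` is
onto** (it is injective between spaces of equal dimension). [cite: LooijengaLunts1997, §1 (1.15) proof, p. 8 L28–L30] -/
theorem exists_pow_apply_eq_of_stable (hgr : IsZGrading h) {a f e' : Module.End K M} (t : IsSl2Triple h a f)
    (Le' : HasLefschetzProperty h e') (hNa : ∀ x ∈ N, a x ∈ N) (hNf : ∀ x ∈ N, f x ∈ N) (hNe' : ∀ x ∈ N, e' x ∈ N)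
    (m : ℕ) {y : M} (hyN : y ∈ N) (hy : y ∈ degreeSpace h m) :
    ∃ x ∈ N, x ∈ degreeSpace h (-(m : ℤ)) ∧ (e' ^ m) x = y := by
  have hpowN : ∀ n : ℕ, ∀ x ∈ N, (e' ^ n) x ∈ N := by
    intro n
    induction n with
    | zero => intro x hx; simpa using hx
    | succ n ih => intro x hx; rw [pow_succ', Module.End.mul_apply]; exact hNe' _ (ih x hx)
  set φ : ↥(N ⊓ degreeSpace h (-(m : ℤ))) →ₗ[K] ↥(N ⊓ degreeSpace h m) :=
    (e' ^ m).restrict fun x hx ↦ ⟨hpowN m x hx.1, by simpa using (Le'.bijOn m).mapsTo hx.2⟩ with hφ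
  have hinj : Injective φ := by
    intro x y hxy
    apply Subtype.ext
    have h1 : (e' ^ m) (x - y : M) = 0 := by
      rw [map_sub, sub_eq_zero]
      simpa [hφ, LinearMap.restrict_apply] using congrArg Subtype.val hxy
    exact sub_eq_zero.1 (Le'.eq_zero_of_pow_apply_eq_zero (n := m) (by omega) (Submodule.sub_mem _ x.2.2 y.2.2)
      (by simpa using h1))
  have hsurj : Surjective φ :=
    (LinearMap.injective_iff_surjective_of_finrank_eq_finrank (finrank_inf_degreeSpace_neg_eq hgr t hNa hNf m)).1 hinj
  obtain ⟨x, hx⟩ := hsurj ⟨y, hyN, hy⟩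
  exact ⟨x, x.2.1, x.2.2, by simpa [hφ, LinearMap.restrict_apply] using congrArg Subtype.val hx⟩

/-- **"`f_{e'}` will also preserve this decomposition (since `f_{e'}` is unique)"**: if `e'` is a Lefschetz operator,
`M'` is `e'`-stable and `e'^m : M'_{-m} → M'_m` is onto for all `m ≥ 0`, then the partner `f_{e'}` (A1-88
`HasLefschetzProperty.dual`, the unique one) maps every homogeneous vector of `M'` into `M'` — `M'` is spanned by
`e'`-strings `p, e' p, …` of primitive vectors `p ∈ M'`, on which `f_{e'}` is André's operator
(`f_{e'} (e'^{i+1} p) = (i+1)(j-i) e'^i p`, `f_{e'} p = 0`). [cite: LooijengaLunts1997, §1 (1.15) proof, p. 8 L28–L30]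
[cite: Andre1996Motifs, §1.1 (formula for ᶜΛ)] -/
theorem dual_apply_mem_of_stable (hgr : IsZGrading h) {e' : Module.End K M} (Le' : HasLefschetzProperty h e')
    (hNe' : ∀ x ∈ N, e' x ∈ N)
    (hsurj : ∀ m : ℕ, ∀ y ∈ N, y ∈ degreeSpace h m → ∃ x ∈ N, x ∈ degreeSpace h (-(m : ℤ)) ∧ (e' ^ m) x = y)
    {m : ℤ} {x : M} (hxN : x ∈ N) (hx : x ∈ degreeSpace h m) : Le'.dual hgr x ∈ N := by
  have hpowN : ∀ n : ℕ, ∀ x ∈ N, (e' ^ n) x ∈ N := by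
    intro n
    induction n with
    | zero => intro x hx; simpa using hx
    | succ n ih => intro x hx; rw [pow_succ', Module.End.mul_apply]; exact hNe' _ (ih x hx)
  -- negative degrees, along strings: `f' (e'^j x) ∈ N` for `x ∈ N ∩ M_{-k}`, by downward induction on `k`
  have key : ∀ d k : ℕ, finrank K M < k + d → ∀ x ∈ N, x ∈ degreeSpace h (-(k : ℤ)) →
      ∀ j : ℕ, Le'.dual hgr ((e' ^ j) x) ∈ N := by
    intro d
    induction d with
    | zero =>
      intro k hk x _ hx j
      have h1 : degreeSpace h (-(k : ℤ)) = ⊥ := Le'.degreeSpace_eq_bot (by rw [abs_neg, Nat.abs_cast]; omega)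
      rw [h1, Submodule.mem_bot] at hx
      rw [hx, map_zero, map_zero]
      exact Submodule.zero_mem _
    | succ d ih =>
      intro k hk x hxN hx j
      -- the two-term decomposition of `x` INSIDE `N`: `x = p + e' y`, `p` primitive, `y ∈ N ∩ M_{-k-2}`
      have hex : (e' ^ (k + 1)) x ∈ degreeSpace h ((k + 2 : ℕ) : ℤ) := by
        have h1 := Le'.pow_apply_mem hx (k + 1)
        convert h1 using 2
        push_cast
        ring
      obtain ⟨y, hyN, hy, hey⟩ := hsurj (k + 2) _ (hpowN (k + 1) x hxN) hex
      have hy' : y ∈ degreeSpace h (-((k : ℤ) + 2)) := by convert hy using 2; push_cast; ring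
      have hp : x - e' y ∈ primitiveSpace h e' k := by
        rw [mem_primitiveSpace_iff]
        refine ⟨Submodule.sub_mem _ hx ?_, ?_⟩
        · have h1 := Le'.apply_mem hy'
          convert h1 using 2
          ring
        · rw [map_sub, ← Module.End.mul_apply, ← pow_succ, hey, sub_self]
      have hpN : x - e' y ∈ N := Submodule.sub_mem _ hxN (hNe' y hyN)
      have hsplit : (e' ^ j) x = (e' ^ j) (x - e' y) + (e' ^ (j + 1)) y := by
        rw [map_sub, pow_succ, Module.End.mul_apply]
        abel
      rw [hsplit, map_add]
      refine Submodule.add_mem _ ?_ (ih (k + 2) (by omega) y hyN hy (j + 1))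
      -- André's formula on the string of the primitive `p = x - e' y ∈ N`
      rcases j with _ | i
      · rw [pow_zero, Module.End.one_apply, Le'.dual_apply_primitive hgr hp]
        exact Submodule.zero_mem _
      · rw [Le'.dual_apply_pow_primitive hgr hp i]
        exact Submodule.smul_mem _ _ (hpowN i _ hpN)
  rcases le_or_gt m 0 with hm | hm
  · obtain ⟨k, hk⟩ : ∃ k : ℕ, m = -(k : ℤ) := ⟨(-m).toNat, by omega⟩
    subst hk
    have h1 := key (finrank K M + 1) k (by omega) x hxN hx 0
    rwa [pow_zero, Module.End.one_apply] at h1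
  · obtain ⟨k, hk⟩ : ∃ k : ℕ, m = (k : ℤ) := ⟨m.toNat, by omega⟩
    subst hk
    obtain ⟨x₀, hx₀N, hx₀, rfl⟩ := hsurj k x hxN hx
    exact key (finrank K M + 1) k (by omega) x₀ hx₀N hx₀ k

end Partner

/-! ### §4 (1.15), first statement, for Lefschetz modules -/

section Main

variable {K : Type*} [Field K] [CharZero K] {M : Type*} [AddCommGroup M] [Module K M] [FiniteDimensional K M]
  {h : Module.End K M} {𝔞 : Submodule K (Module.End K M)}

/-- **An operator `e'` of degree `2` commuting with `a` satisfies `[f, [f, [f, e']]] = 0`** for an `𝔰𝔩₂`-triple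
`(a, h, f)`: `e'` is a highest weight vector of weight `2` for the triple acting on `𝔤𝔩(M)` by `ad`, whose string
`e', [f, e'], [f, [f, e']]` is a copy of `V(2)` (Mathlib `pow_toEnd_f_eq_zero_of_eq_nat`).
[cite: LooijengaLunts1997, §1 (1.15) proof, p. 8 L24–L28 ("any linear transformation in M of degree two that commutes with e")] -/
theorem lie_f_lie_f_lie_f_eq_zero {a f e' : Module.End K M} (t : IsSl2Triple h a f) (hae' : ⁅a, e'⁆ = 0)
    (hhe' : ⁅h, e'⁆ = (2 : K) • e') : ⁅f, ⁅f, ⁅f, e'⁆⁆⁆ = 0 := by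
  by_cases h0 : e' = 0
  · rw [h0, lie_zero, lie_zero, lie_zero]
  · have P : t.HasPrimitiveVectorWith (M := Module.End K M) e' ((2 : ℕ) : K) :=
      { ne_zero := h0
        lie_h := by rw [hhe', Nat.cast_ofNat]
        lie_e := hae' }
    have h1 := P.pow_toEnd_f_eq_zero_of_eq_nat (n := 2) rfl
    simpa only [pow_succ, pow_zero, one_mul, Module.End.mul_apply, LieModule.toEnd_apply_apply] using h1

/-- **`M' = M^{(≤ k)}` is `𝔤(𝔞, M)`-stable when `V(k+2)` does not occur** ("this applies in particular to any
`e' ∈ 𝔞`. If `e'` has the Lefschetz property, then `f_{e'}` will also preserve this decomposition … and hence `𝔤`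
will"): for a Lefschetz module `(𝔞, M)`, an `𝔰𝔩₂`-triple `(a, h, f)` with `a ∈ 𝔞` and `k` with
`P_{-k-2} = 0`, every element of `𝔤(𝔞, M)` maps `typeLE h f k` into itself.
[cite: LooijengaLunts1997, §1 (1.15) proof, p. 8 L24–L31] -/
theorem IsLefschetzModule.typeLE_stable (A : IsLefschetzModule K h 𝔞) {a f : Module.End K M} (ha : a ∈ 𝔞)
    (t : IsSl2Triple h a f) {k : ℕ} (hk2 : primitiveSpace h a (k + 2) = ⊥) {x : Module.End K M}
    (hx : x ∈ lefschetzLieAlgebra K h 𝔞) : ∀ v ∈ typeLE h f k, x v ∈ typeLE h f k := by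
  have hgr := A.isZGrading
  have hgap : degreeSpace h (-((k + 2 : ℕ) : ℤ)) ⊓ LinearMap.ker f = ⊥ := by
    rw [← primitiveSpace_eq_inf_ker hgr t (k + 2), hk2]
  -- the generators `e' ∈ 𝔞`
  have hE : ∀ e' ∈ 𝔞, ∀ v ∈ typeLE h f k, e' v ∈ typeLE h f k := by
    intro e' he' v hv
    refine typeLE_stable_of_lie_eq_zero t.lie_h_f_nsmul (A.mapsTo he') ?_ hgap hv
    exact lie_f_lie_f_lie_f_eq_zero t (A.lie_eq_zero a ha e' he') (mem_adDegree_iff.1 (A.le_adDegree_two he'))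
  have hN_a : ∀ v ∈ typeLE h f k, a v ∈ typeLE h f k := hE a ha
  have hN_f : ∀ v ∈ typeLE h f k, f v ∈ typeLE h f k := fun v hv ↦ f_apply_mem_typeLE t.lie_h_f_nsmul hv
  rw [lefschetzLieAlgebra] at hx
  induction hx using LieSubalgebra.lieSpan_induction with
  | mem x hx =>
    rcases hx with hx | ⟨e', he', t'⟩
    · exact hE x hx
    · -- `x = f_{e'}`, the (unique) partner of a Lefschetz `e' ∈ 𝔞`
      have Le' := hasLefschetzProperty_of_isSl2Triple hgr t'
      rw [Le'.eq_dual_of_isSl2Triple hgr t']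
      intro v hv
      refine typeLE_induction (p := fun v ↦ Le'.dual hgr v ∈ typeLE h f k) (fun s v hv hfv ↦ ?_)
        (by rw [map_zero]; exact Submodule.zero_mem _)
        (fun x y hx hy ↦ by rw [map_add]; exact Submodule.add_mem _ hx hy) hv
      · exact dual_apply_mem_of_stable hgr Le' (hE e' he')
          (fun m y hyN hy ↦ exists_pow_apply_eq_of_stable hgr t Le' hN_a hN_f (hE e' he') m hyN hy)
          (mem_typeLE hv hfv) hv
  | zero => intro v _; rw [LinearMap.zero_apply]; exact Submodule.zero_mem _
  | add x y _ _ hx hy => intro v hv; rw [LinearMap.add_apply]; exact Submodule.add_mem _ (hx v hv) (hy v hv)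
  | smul c x _ hx => intro v hv; rw [LinearMap.smul_apply]; exact Submodule.smul_mem _ c (hx v hv)
  | lie x y _ _ hx hy =>
    intro v hv
    rw [Ring.lie_def, LinearMap.sub_apply, Module.End.mul_apply, Module.End.mul_apply]
    exact Submodule.sub_mem _ (hx _ (hy v hv)) (hy _ (hx v hv))

/-- **(1.15), first statement, the key step: if `M` contains `V(k)` but not `V(k+2)`, then `M` contains no
`V(j)`, `j > k+2` — indeed `M_m = 0` for all `m < -k`.**  Printed proof: `M' = M^{(≤ k)}` is `𝔤(𝔞, M)`-stable
(`typeLE_stable`) and non-zero (it contains `P_{-k} ≠ 0`), so by irreducibility `M' = M`; and `M' ⊆ M_{≥ -k}`.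
("Suppose `I` is not an arithmetic progression with increment `2`. Then there exists an integer `k` such that `M`
contains `V(k)` and `V(k+2l)` for some `l ≥ 2`, but not `V(k+2)` … This contradicts our assumption that `M` is
irreducible.") [cite: LooijengaLunts1997, §1 (1.15) Proposition and proof, p. 7 L106 – p. 8 L33] -/
theorem IsLefschetzModule.degreeSpace_eq_bot_of_primitiveSpace_eq_bot (A : IsLefschetzModule K h 𝔞)
    [LieModule.IsIrreducible K (lefschetzLieAlgebra K h 𝔞) M] {a f : Module.End K M} (ha : a ∈ 𝔞)
    (t : IsSl2Triple h a f) {k : ℕ} (hk : primitiveSpace h a k ≠ ⊥) (hk2 : primitiveSpace h a (k + 2) = ⊥)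
    {m : ℤ} (hm : m < -(k : ℤ)) : degreeSpace h m = ⊥ := by
  have hgr := A.isZGrading
  haveI : Nontrivial M := by
    obtain ⟨x, -, hx0⟩ := Submodule.exists_mem_ne_zero_of_ne_bot hk
    exact nontrivial_of_ne x 0 hx0
  -- `M'` is `𝔤(𝔞, M)`-stable and non-zero, hence everything
  have htop : typeLE h f k = ⊤ := by
    rcases (isIrreducible_iff_forall_stable (h := h) (𝔞 := 𝔞)).1 ‹_› (typeLE h f k)
      (fun x hx ↦ A.typeLE_stable ha t hk2 hx) with h1 | h1
    · exfalso
      apply hk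
      rw [eq_bot_iff, ← h1, primitiveSpace_eq_inf_ker hgr t k]
      rintro x ⟨hx, hfx⟩
      exact mem_typeLE_of_apply_eq_zero hx (LinearMap.mem_ker.1 hfx)
    · exact h1
  -- `M_m ⊆ M' ⊆ M_{≥ -k}` is disjoint from `M_m` for `m < -k`
  have h1 : degreeSpace h m ≤ ⨆ n : ℤ, ⨆ (_ : -(k : ℤ) ≤ n), degreeSpace h n :=
    (le_top.trans htop.ge).trans (typeLE_le_biSup k)
  exact (disjoint_degreeSpace_biSup hm).eq_bot_of_le h1

/-- **… so `k` is the depth `n` of `M`**: if `V(k)` occurs in an irreducible Lefschetz module and `V(k+2)` does not,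
then `k = n` ("the dimensions … make up an arithmetic progression with increment `2`" — it ends at `n`).
[cite: LooijengaLunts1997, §1 (1.15) Proposition, p. 7 L106 – p. 8 L5] -/
theorem IsLefschetzModule.depth_eq_of_primitiveSpace_eq_bot (A : IsLefschetzModule K h 𝔞)
    [LieModule.IsIrreducible K (lefschetzLieAlgebra K h 𝔞) M] {a f : Module.End K M} (ha : a ∈ 𝔞)
    (t : IsSl2Triple h a f) {k : ℕ} (hk : primitiveSpace h a k ≠ ⊥) (hk2 : primitiveSpace h a (k + 2) = ⊥) :
    depth h = k := by
  have hgr := A.isZGrading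
  have La := hasLefschetzProperty_of_isSl2Triple hgr t
  refine le_antisymm ?_ (La.le_depth fun h0 ↦ hk ?_)
  · -- `M_n = 0` for `n > k` (as `M_{-n} = 0` and `a^n : M_{-n} ≅ M_n`)
    by_contra hlt
    have hlt' : k < depth h := not_le.1 hlt
    have h1 : degreeSpace h (-(depth h : ℤ)) = ⊥ :=
      A.degreeSpace_eq_bot_of_primitiveSpace_eq_bot ha t hk hk2 (by omega)
    haveI : Nontrivial M := by
      obtain ⟨x, -, hx0⟩ := Submodule.exists_mem_ne_zero_of_ne_bot hk
      exact nontrivial_of_ne x 0 hx0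
    exact La.degreeSpace_neg_depth_ne_bot hgr h1
  · -- `P_{-k} ⊆ M_{-k} ≅ M_k = 0`
    rw [eq_bot_iff]
    intro x hx
    have hx' := (mem_primitiveSpace_iff.1 hx).1
    have h1 : (a ^ k) x ∈ degreeSpace h (k : ℤ) := by simpa using (La.bijOn k).mapsTo hx'
    rw [h0, Submodule.mem_bot] at h1
    rw [Submodule.mem_bot]
    exact La.eq_zero_of_pow_apply_eq_zero (n := k) (by omega) hx' (by simpa using h1)

/-- **(1.15), first statement: "the dimensions of the irreducible `𝔰𝔩(2)`-representations that occur in the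
`𝔰𝔩(2)`-type of `M` make up an arithmetic progression with increment `2`"** — no gaps: if `V(j)` occurs in an
irreducible Lefschetz module of depth `n` and `j + 2 ≤ n`, then `V(j+2)` occurs.
[cite: LooijengaLunts1997, §1 (1.15) Proposition, p. 7 L106 – p. 8 L5] -/
theorem IsLefschetzModule.primitiveSpace_add_two_ne_bot (A : IsLefschetzModule K h 𝔞)
    [LieModule.IsIrreducible K (lefschetzLieAlgebra K h 𝔞) M] {a f : Module.End K M} (ha : a ∈ 𝔞)
    (t : IsSl2Triple h a f) {j : ℕ} (hj : primitiveSpace h a j ≠ ⊥) (hjn : j + 2 ≤ depth h) :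
    primitiveSpace h a (j + 2) ≠ ⊥ := fun hj2 ↦ by
  have h1 := A.depth_eq_of_primitiveSpace_eq_bot ha t hj hj2
  omega

/-- `V(n)` occurs, `n` the depth (`M ≠ 0`): `P_{-n} = M_{-n} ≠ 0` (`a^{n+1}` maps `M_{-n}` to `M_{n+2} = 0`).
[cite: LooijengaLunts1997, §1 (1.15) p. 8 L2 ("dim M_{-n} < …"), (1.1) p. 4 L58–L60] -/
theorem primitiveSpace_depth_ne_bot [Nontrivial M] (hgr : IsZGrading h) {a : Module.End K M}
    (La : HasLefschetzProperty h a) : primitiveSpace h a (depth h) ≠ ⊥ := by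
  intro h0
  apply La.degreeSpace_neg_depth_ne_bot hgr
  rw [eq_bot_iff, ← h0]
  intro x hx
  rw [mem_primitiveSpace_iff]
  refine ⟨hx, ?_⟩
  have h1 : (a ^ (depth h + 1)) x ∈ degreeSpace h ((depth h + 2 : ℕ) : ℤ) := by
    have h2 := La.pow_apply_mem hx (depth h + 1)
    convert h2 using 2
    push_cast
    ring
  rw [La.degreeSpace_eq_bot_of_depth_lt (by omega), Submodule.mem_bot] at h1
  exact h1

/-- **(1.15), the occurring types form an initial segment from the top: there is `r`, `0 ≤ r ≤ ⌊n/2⌋`, such that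
for `2t ≤ n` the type `V(n - 2t)` occurs iff `t ≤ r`** ("there exists an integer `r` with `0 ≤ r ≤ ⌊n/2⌋` such
that `dim M_{-n} < ⋯ < dim M_{-n+2r} = dim M_{-n+2r+2} = ⋯`"). [cite: LooijengaLunts1997, §1 (1.15) Proposition, p. 8 L1–L5] -/
theorem IsLefschetzModule.exists_primitiveSpace_ne_bot_iff (A : IsLefschetzModule K h 𝔞) [Nontrivial M]
    [LieModule.IsIrreducible K (lefschetzLieAlgebra K h 𝔞) M] {a f : Module.End K M} (ha : a ∈ 𝔞)
    (t : IsSl2Triple h a f) :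
    ∃ r : ℕ, 2 * r ≤ depth h ∧ ∀ t : ℕ, 2 * t ≤ depth h → (primitiveSpace h a (depth h - 2 * t) ≠ ⊥ ↔ t ≤ r) := by
  have hgr := A.isZGrading
  have La := hasLefschetzProperty_of_isSl2Triple hgr t
  classical
  -- `r` = the largest `t ≤ n/2` with `V(n - 2t)` occurring (`t = 0` occurs)
  let S : Finset ℕ := (Finset.range (depth h / 2 + 1)).filter fun t ↦ primitiveSpace h a (depth h - 2 * t) ≠ ⊥
  have hmemS : ∀ t, t ∈ S ↔ t < depth h / 2 + 1 ∧ primitiveSpace h a (depth h - 2 * t) ≠ ⊥ := fun t ↦ by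
    simp only [S, Finset.mem_filter, Finset.mem_range]
  have h0S : 0 ∈ S := (hmemS 0).2 ⟨by omega, by simpa using primitiveSpace_depth_ne_bot hgr La⟩
  have hSne : S.Nonempty := ⟨0, h0S⟩
  set r := S.max' hSne with hr_def
  have hr := (hmemS r).1 (Finset.max'_mem S hSne)
  refine ⟨r, by omega, fun s hs ↦ ⟨fun hP ↦ ?_, fun hsr ↦ ?_⟩⟩
  · exact Finset.le_max' S s ((hmemS s).2 ⟨by omega, hP⟩)
  · -- downward from `r`: `V(n - 2r)` occurs, hence `V(n - 2r + 2)`, …, `V(n - 2s)`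
    obtain ⟨d, hd⟩ := Nat.exists_eq_add_of_le hsr
    have key : ∀ i : ℕ, i ≤ d → primitiveSpace h a (depth h - 2 * r + 2 * i) ≠ ⊥ := by
      intro i
      induction i with
      | zero => intro _; simpa using hr.2
      | succ i ih =>
        intro hi
        have h1 := A.primitiveSpace_add_two_ne_bot ha t (ih (by omega)) (by omega)
        convert h1 using 2
        all_goals omega
    have h1 := key d le_rfl
    convert h1 using 2
    all_goals omega

end Main

/-! ### §5 "In other words": the dimensions `dim M_{-n+2t}` -/

section Dimensions

variable {K : Type*} [Field K] {M : Type*} [AddCommGroup M] [Module K M] [FiniteDimensional K M]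
  {h a : Module.End K M}

/-- **`dim M_{-j} = dim P_{-j} + dim M_{-j-2}`** for a Lefschetz operator (the two-term primitive decomposition
`M_{-j} = P_{-j} ⊕ a·M_{-j-2}` of A1-88, `a` injective on `M_{-j-2}`): the number of copies of `V(j)` is the jump
of `t ↦ dim M_{-n+2t}`. [cite: LooijengaLunts1997, §1 (1.15) p. 8 L1–L5 ("In other words, … dim M_{-n} < dim M_{-n+2} < ⋯")] -/
theorem finrank_degreeSpace_neg_eq_add (La : HasLefschetzProperty h a) (j : ℕ) :
    finrank K ↥(degreeSpace h (-(j : ℤ))) =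
      finrank K ↥(primitiveSpace h a j) + finrank K ↥(degreeSpace h (-((j : ℤ) + 2))) := by
  -- the linear bijection `(p, y) ↦ p + a y`
  set φ : ↥(primitiveSpace h a j) × ↥(degreeSpace h (-((j : ℤ) + 2))) →ₗ[K] ↥(degreeSpace h (-(j : ℤ))) :=
    { toFun := fun py ↦ ⟨(py.1 : M) + a py.2, Submodule.add_mem _ (mem_primitiveSpace_iff.1 py.1.2).1
        (by have h1 := La.apply_mem py.2.2; convert h1 using 2; ring)⟩
      map_add' := fun x y ↦ by ext; simp only [Prod.fst_add, Prod.snd_add, Submodule.coe_add, map_add]; abel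
      map_smul' := fun c x ↦ by ext; simp [smul_add] } with hφ
  have hbij : Bijective φ := by
    constructor
    · rintro ⟨p, y⟩ ⟨p', y'⟩ hpy
      have h1 : (p : M) + a y = p' + a y' := by simpa [hφ] using congrArg Subtype.val hpy
      obtain ⟨h2, h3⟩ := La.primitive_add_unique p.2 p'.2 y.2 y'.2 h1
      exact Prod.ext (Subtype.ext h2) (Subtype.ext h3)
    · rintro ⟨x, hx⟩
      obtain ⟨p, hp, y, hy, hxy⟩ := La.exists_primitive_add hx
      exact ⟨(⟨p, hp⟩, ⟨y, hy⟩), Subtype.ext (by simpa [hφ] using hxy.symm)⟩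
  rw [← (LinearEquiv.ofBijective φ hbij).finrank_eq, Module.finrank_prod]

omit [FiniteDimensional K M] in
/-- `dim M_j = dim M_{-j}` (`a^j : M_{-j} ≅ M_j`). [cite: LooijengaLunts1997, §1 (1.15) p. 8 L3–L5 ("= dim M_{n-2r} < ⋯ < dim M_n")] -/
theorem finrank_degreeSpace_eq_neg (La : HasLefschetzProperty h a) (j : ℕ) :
    finrank K ↥(degreeSpace h (j : ℤ)) = finrank K ↥(degreeSpace h (-(j : ℤ))) :=
  ((La.powEquiv (n := (j : ℤ)) (by omega)).finrank_eq).symm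

/-- `t ↦ dim M_{-n+2t}` never decreases while `-n + 2t ≤ 0`: `dim M_{-j-2} ≤ dim M_{-j}`. [cite: LooijengaLunts1997, §1 (1.15) p. 8 L1–L5] -/
theorem finrank_degreeSpace_neg_add_two_le (La : HasLefschetzProperty h a) (j : ℕ) :
    finrank K ↥(degreeSpace h (-((j : ℤ) + 2))) ≤ finrank K ↥(degreeSpace h (-(j : ℤ))) := by
  rw [finrank_degreeSpace_neg_eq_add La j]
  omega

/-- … and jumps exactly where a type occurs: `dim M_{-j-2} < dim M_{-j} ↔ P_{-j} ≠ 0`. [cite: LooijengaLunts1997, §1 (1.15) p. 8 L1–L5] -/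
theorem finrank_degreeSpace_neg_add_two_lt_iff (La : HasLefschetzProperty h a) (j : ℕ) :
    finrank K ↥(degreeSpace h (-((j : ℤ) + 2))) < finrank K ↥(degreeSpace h (-(j : ℤ))) ↔
      primitiveSpace h a j ≠ ⊥ := by
  rw [finrank_degreeSpace_neg_eq_add La j, Ne, ← Submodule.finrank_eq_zero (R := K) (M := M)]
  omega

variable {𝔞 : Submodule K (Module.End K M)}

/-- **(1.15) "in other words", strict part: `dim M_{-n+2t-2} < dim M_{-n+2t}` for `1 ≤ t ≤ r`** (with `r` as in
`exists_primitiveSpace_ne_bot_iff`: the `t ≤ r` are exactly those with `V(n-2t)` occurring). [cite: LooijengaLunts1997, §1 (1.15) Proposition, p. 8 L1–L5] -/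
theorem finrank_lt_of_primitiveSpace_ne_bot {a : Module.End K M} (La : HasLefschetzProperty h a)
    {n t : ℕ} (ht : 2 * t ≤ n) (hP : primitiveSpace h a (n - 2 * t) ≠ ⊥) :
    finrank K ↥(degreeSpace h (-((n : ℤ) - 2 * t + 2))) < finrank K ↥(degreeSpace h (-((n : ℤ) - 2 * t))) := by
  have h1 := (finrank_degreeSpace_neg_add_two_lt_iff La (n - 2 * t)).2 hP
  have h2 : ((n - 2 * t : ℕ) : ℤ) = (n : ℤ) - 2 * t := by omega
  rwa [h2] at h1

/-- **(1.15) "in other words", constant part: `dim M_{-n+2t-2} = dim M_{-n+2t}` when `V(n - 2t)` does not occur**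
(`r < t ≤ ⌊n/2⌋`). [cite: LooijengaLunts1997, §1 (1.15) Proposition, p. 8 L1–L5] -/
theorem finrank_eq_of_primitiveSpace_eq_bot {a : Module.End K M} (La : HasLefschetzProperty h a)
    {n t : ℕ} (ht : 2 * t ≤ n) (hP : primitiveSpace h a (n - 2 * t) = ⊥) :
    finrank K ↥(degreeSpace h (-((n : ℤ) - 2 * t + 2))) = finrank K ↥(degreeSpace h (-((n : ℤ) - 2 * t))) := by
  have h1 := finrank_degreeSpace_neg_eq_add La (n - 2 * t)
  have h2 : ((n - 2 * t : ℕ) : ℤ) = (n : ℤ) - 2 * t := by omega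
  rw [h2, hP, finrank_bot, zero_add] at h1
  exact h1.symm

end Dimensions

end Literature.Algebra.Lie
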